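import Mathlib
import Summits.ValiantsHypothesis.ValiantsHypothesis.Theorems.BinomialElusiveBinomialCandidateCorankOneNormalForm
import Summits.ValiantsHypothesis.ValiantsHypothesis.Theorems.BinomialElusiveBinomialCandidateCorankTwoLinearAlgebra

/-!
# Crux `BinomialElusive.BinomialCandidate` (stmt-ValiantsHypothesis-7392), line `registered`
# (skeleton v6) — stub `stub_nondegenerateCorankTwo`, piece B: the corank-two normal form

Data: a quadratic map `Γ : ℂ^{n₀+2} → ℂ^{n₀+3}`, an integral solution `p` of `Γ(p) = T` (`T` of
positive order), two independent kernel vectors `κ₁, κ₂` of the Jacobian `J = (∂_jΓ_i(y₀))` at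
the base point `y₀ = p(0)` spanning the kernel (corank exactly two), and three independent row
vectors `λ_0, λ_1, λ_2` killing the image of `J`.  `corankTwo_normalForm` is the normal form
consumed by the Picard elimination of the nondegenerate corank-two package: invertible matrices
`P` (target) and `S` (source) with `S e_0 = κ₁`, `S e_1 = κ₂`, rows `0, 1, 2` of `P` the
prescribed `λ_a`, and `P J S = E` (`corankTwo_linearAlgebra`), polynomials `B_i` of total degree
`≤ 2` without monomials of degree `< 2`, series `q_j` of positive order with `p = y₀ + S q`, the
polynomial identities `Σ_{i'} P_{i i'} Γ_{i'}(y₀ + S Y) = [Y_{i-1}] + B_i(Y)` (the bracket present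
for the regular target indices `i ≥ 3` only), and the solution identities
`q_j + B_{j+1}(q) = T̂_{j+1}` (`j ≥ 2`), `B_a(q) = T̂_a` (`a = 0, 1, 2`), `T̂ = P T`.

This is the corank-one normal form `corankOne_normalForm` with one more kernel direction and one
more special target coordinate; the proof is the same Taylor expansion
(`JetReduction.affineTaylor`) and coordinate calculus, with the `E`-linear-form lemmas
`CorankTwo.linear_E_*`; the total degree bound is `JetReduction.totalDegree_aeval_le_of_le_one`.
-/

-- layout Summits/ValiantsHypothesis/ValiantsHypothesis forces the duplicated namespace component
set_option linter.dupNamespace false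

noncomputable section

namespace Summit.ValiantsHypothesis.ValiantsHypothesis.Theorems.BinomialCandidateStubs

open scoped BigOperators
open MvPolynomial

open CorankTwo JetReduction in
/-- **Corank-two normal form** (piece B of the stub `stub_nondegenerateCorankTwo`); see the module
docstring. -/
theorem corankTwo_normalForm :
    ∀ (n₀ : ℕ) (Γ : Fin (n₀ + 3) → MvPolynomial (Fin (n₀ + 2)) ℂ)
      (p : Fin (n₀ + 2) → LaurentSeries ℂ) (T : Fin (n₀ + 3) → LaurentSeries ℂ)
      (κ₁ κ₂ : Fin (n₀ + 2) → ℂ) (lam : Fin 3 → Fin (n₀ + 3) → ℂ),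
      (∀ i, (Γ i).totalDegree ≤ 2) → (∀ j, 0 ≤ (p j).order) →
      (∀ i, ∀ g : ℤ, g < 1 → (T i).coeff g = 0) →
      (∀ i, MvPolynomial.aeval p (Γ i) = T i) →
      (∀ i, ∑ j, κ₁ j * MvPolynomial.eval (fun l => (p l).coeff 0) (MvPolynomial.pderiv j (Γ i)) = 0) →
      (∀ i, ∑ j, κ₂ j * MvPolynomial.eval (fun l => (p l).coeff 0) (MvPolynomial.pderiv j (Γ i)) = 0) →
      (∀ c₁ c₂ : ℂ, c₁ • κ₁ + c₂ • κ₂ = 0 → c₁ = 0 ∧ c₂ = 0) →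
      (∀ κ' : Fin (n₀ + 2) → ℂ, (∀ i, ∑ j, κ' j * MvPolynomial.eval (fun l => (p l).coeff 0)
        (MvPolynomial.pderiv j (Γ i)) = 0) → ∃ μ₁ μ₂ : ℂ, κ' = μ₁ • κ₁ + μ₂ • κ₂) →
      (∀ a : Fin 3, ∀ j : Fin (n₀ + 2),
        ∑ i, lam a i * MvPolynomial.eval (fun l => (p l).coeff 0) (MvPolynomial.pderiv j (Γ i)) = 0) →
      (∀ c : Fin 3 → ℂ, (∀ i, ∑ a, c a * lam a i = 0) → c = 0) →
      ∃ (P P' : Matrix (Fin (n₀ + 3)) (Fin (n₀ + 3)) ℂ) (S S' : Matrix (Fin (n₀ + 2)) (Fin (n₀ + 2)) ℂ)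
        (B : Fin (n₀ + 3) → MvPolynomial (Fin (n₀ + 2)) ℂ) (q : Fin (n₀ + 2) → LaurentSeries ℂ),
        P * P' = 1 ∧ P' * P = 1 ∧ S * S' = 1 ∧ S' * S = 1 ∧
        (∀ j, S j 0 = κ₁ j) ∧ (∀ j, S j 1 = κ₂ j) ∧
        (∀ i, P 0 i = lam 0 i ∧ P 1 i = lam 1 i ∧ P 2 i = lam 2 i) ∧
        (∀ i, (B i).totalDegree ≤ 2) ∧
        (∀ i, ∀ d : Fin (n₀ + 2) →₀ ℕ, d.degree < 2 → MvPolynomial.coeff d (B i) = 0) ∧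
        (∀ j, ∀ g : ℤ, g < 1 → (q j).coeff g = 0) ∧
        (∀ j, p j = algebraMap ℂ (LaurentSeries ℂ) ((p j).coeff 0) +
          ∑ l, algebraMap ℂ (LaurentSeries ℂ) (S j l) * q l) ∧
        (∀ j' : Fin n₀, ∑ i', MvPolynomial.C (P j'.succ.succ.succ i') *
            MvPolynomial.aeval (fun j => MvPolynomial.C ((p j).coeff 0) + ∑ l, MvPolynomial.C (S j l) * MvPolynomial.X l)
              (Γ i') = MvPolynomial.X j'.succ.succ + B j'.succ.succ.succ) ∧
        (∑ i', MvPolynomial.C (P 0 i') *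
            MvPolynomial.aeval (fun j => MvPolynomial.C ((p j).coeff 0) + ∑ l, MvPolynomial.C (S j l) * MvPolynomial.X l)
              (Γ i') = B 0) ∧
        (∑ i', MvPolynomial.C (P 1 i') *
            MvPolynomial.aeval (fun j => MvPolynomial.C ((p j).coeff 0) + ∑ l, MvPolynomial.C (S j l) * MvPolynomial.X l)
              (Γ i') = B 1) ∧
        (∑ i', MvPolynomial.C (P 2 i') *
            MvPolynomial.aeval (fun j => MvPolynomial.C ((p j).coeff 0) + ∑ l, MvPolynomial.C (S j l) * MvPolynomial.X l)
              (Γ i') = B 2) ∧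
        (∀ j' : Fin n₀, q j'.succ.succ + MvPolynomial.aeval q (B j'.succ.succ.succ) =
          ∑ i', algebraMap ℂ (LaurentSeries ℂ) (P j'.succ.succ.succ i') * T i') ∧
        MvPolynomial.aeval q (B 0) = ∑ i', algebraMap ℂ (LaurentSeries ℂ) (P 0 i') * T i' ∧
        MvPolynomial.aeval q (B 1) = ∑ i', algebraMap ℂ (LaurentSeries ℂ) (P 1 i') * T i' ∧
        MvPolynomial.aeval q (B 2) = ∑ i', algebraMap ℂ (LaurentSeries ℂ) (P 2 i') * T i' := by
  intro n₀ Γ p T κ₁ κ₂ lam hΓ hp hT hsol hker₁ hker₂ hκ hcorank hlamJ hlam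
  classical
  have hF := JetReduction.laurentGE_isFilt
  set F : ℕ → LaurentSeries ℂ → Prop := fun m z => ∀ g : ℤ, g < m → z.coeff g = 0 with hFdef
  set y₀ : Fin (n₀ + 2) → ℂ := fun l => (p l).coeff 0 with hy₀
  set J : Matrix (Fin (n₀ + 3)) (Fin (n₀ + 2)) ℂ := Matrix.of fun i j => eval y₀ (pderiv j (Γ i))
    with hJ
  -- the kernel and cokernel hypotheses in matrix form
  have hJmul : ∀ v : Fin (n₀ + 2) → ℂ, ∀ i, J.mulVec v i = ∑ j, v j * eval y₀ (pderiv j (Γ i)) :=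
    fun v i => by
      simp only [Matrix.mulVec, dotProduct, hJ, Matrix.of_apply]
      exact Finset.sum_congr rfl fun j _ => mul_comm _ _
  have hJκ₁ : J.mulVec κ₁ = 0 := funext fun i => by rw [hJmul]; exact hker₁ i
  have hJκ₂ : J.mulVec κ₂ = 0 := funext fun i => by rw [hJmul]; exact hker₂ i
  have hcorank' : ∀ κ' : Fin (n₀ + 2) → ℂ, J.mulVec κ' = 0 → ∃ μ₁ μ₂ : ℂ, κ' = μ₁ • κ₁ + μ₂ • κ₂ :=
    fun κ' h => hcorank κ' fun i => by rw [← hJmul]; exact congrFun h i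
  have hlamJ' : ∀ a j, ∑ i, lam a i * J i j = 0 := fun a j => by
    simp only [hJ, Matrix.of_apply]
    exact hlamJ a j
  obtain ⟨P, P', S, S', hPP', hP'P, hSS', hS'S, hS0, hS1, hProws, hE0, hE1, hEs⟩ :=
    corankTwo_linearAlgebra n₀ J κ₁ κ₂ lam hJκ₁ hJκ₂ hκ hcorank' hlamJ' hlam
  -- the base point and the translated solution
  set q₀ : Fin (n₀ + 2) → LaurentSeries ℂ := fun j => p j - algebraMap ℂ (LaurentSeries ℂ) (y₀ j)
    with hq₀
  have q₀_mem : ∀ j, F 1 (q₀ j) := by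
    intro j g hg
    simp only [hq₀, HahnSeries.coeff_sub', Pi.sub_apply, AffinePeeling.algebraMap_laurentSeries_apply]
    by_cases hg0 : g = 0
    · subst hg0
      rw [HahnSeries.coeff_single_same, hy₀, sub_self]
    · rw [HahnSeries.coeff_single_of_ne hg0, sub_zero]
      exact HahnSeries.coeff_eq_zero_of_lt_order (lt_of_lt_of_le (by push_cast at hg; omega) (hp j))
  have hT' : ∀ i, F 1 (T i) := fun i g hg => hT i g (by exact_mod_cast hg)
  -- source coordinates `S`, Taylor expansion
  set phi : Fin (n₀ + 2) → MvPolynomial (Fin (n₀ + 2)) ℂ := fun j => ∑ l, C (S j l) * X l with hphi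
  set Γt : Fin (n₀ + 3) → MvPolynomial (Fin (n₀ + 2)) ℂ :=
    fun i => aeval (fun j => C (y₀ j) + phi j) (Γ i) with hΓt
  set Lin : Fin (n₀ + 3) → MvPolynomial (Fin (n₀ + 2)) ℂ :=
    fun i => ∑ j, C (eval y₀ (pderiv j (Γ i))) * phi j with hLin
  set q : Fin (n₀ + 2) → LaurentSeries ℂ :=
    fun j => ∑ l, algebraMap ℂ (LaurentSeries ℂ) (S' j l) * q₀ l with hq
  have phi_mem : ∀ j, ∀ d : Fin (n₀ + 2) →₀ ℕ, d.degree < 1 → coeff d (phi j) = 0 := fun j =>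
    degGE_sum _ fun l _ => degGE_C_mul _ (degGE_X l)
  have Lin_mem : ∀ i, ∀ d : Fin (n₀ + 2) →₀ ℕ, d.degree < 1 → coeff d (Lin i) = 0 := fun i =>
    degGE_sum _ fun j _ => degGE_C_mul _ (phi_mem j)
  have taylor : ∀ i, ∀ d : Fin (n₀ + 2) →₀ ℕ, d.degree < 2 →
      coeff d (Γt i - (C (eval y₀ (Γ i)) + Lin i)) = 0 := fun i =>
    affineTaylor y₀ phi phi_mem (Γ i)
  have q_mem : ∀ j, F 1 (q j) := fun j =>
    filt_sum hF _ _ fun l _ => filt_algebraMap_mul hF _ (q₀_mem l)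
  have aeval_q_lin : ∀ j, aeval q (C (y₀ j) + phi j) =
      algebraMap ℂ (LaurentSeries ℂ) (y₀ j) + ∑ l, algebraMap ℂ (LaurentSeries ℂ) (S j l) * q l :=
    fun j => by rw [map_add, aeval_C, hphi, aeval_linear]
  have aeval_q_phi : ∀ j, aeval q (C (y₀ j) + phi j) = p j := fun j => by
    rw [aeval_q_lin, hq]
    simp only
    rw [sum_algebraMap_mul_sum hSS' q₀ j, hq₀]
    simp only [add_sub_cancel]
  have aeval_q_Γt : ∀ i, aeval q (Γt i) = T i := fun i => by
    rw [hΓt]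
    simp only
    rw [aeval_aeval]
    simp_rw [aeval_q_phi]
    exact hsol i
  have eval_y₀ : ∀ i, eval y₀ (Γ i) = 0 := fun i => by
    have h1 : F 1 (aeval q (Γt i - (C (eval y₀ (Γ i)) + Lin i))) :=
      hF.2.2.2.1 1 2 _ one_le_two (filt_aeval hF (taylor i) q_mem)
    have h2 : F 1 (aeval q (Lin i)) := filt_aeval hF (Lin_mem i) q_mem
    have h3 := filt_sub hF (filt_sub hF (hT' i) h1) h2
    rw [map_sub, map_add, aeval_C, aeval_q_Γt] at h3
    have h4 : F 1 (algebraMap ℂ (LaurentSeries ℂ) (eval y₀ (Γ i))) := by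
      convert h3 using 1; ring
    have := h4 0 (by norm_num)
    rwa [AffinePeeling.algebraMap_laurentSeries_apply, HahnSeries.coeff_single_same] at this
  have Bt_mem : ∀ i, ∀ d : Fin (n₀ + 2) →₀ ℕ, d.degree < 2 → coeff d (Γt i - Lin i) = 0 :=
    fun i => by
      have := taylor i
      rwa [eval_y₀ i, C_0, zero_add] at this
  have Lin_eq : ∀ i, Lin i = ∑ l, C ((J * S) i l) * X l := fun i => by
    rw [hLin, hphi]
    simp only [Matrix.mul_apply, hJ, Matrix.of_apply]
    exact sum_C_mul_linear _ _
  -- total degrees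
  have Γt_deg : ∀ i, (Γt i).totalDegree ≤ 2 := fun i =>
    (totalDegree_aeval_le_of_le_one _ _ fun j =>
      (totalDegree_add _ _).trans (max_le (by simp) (totalDegree_linear_le_one _))).trans (hΓ i)
  have Bt_deg : ∀ i, (Γt i - Lin i).totalDegree ≤ 2 := fun i =>
    (totalDegree_sub _ _).trans (max_le (Γt_deg i) (by
      rw [Lin_eq]; exact (totalDegree_linear_le_one _).trans one_le_two))
  -- target coordinates `P`
  set B : Fin (n₀ + 3) → MvPolynomial (Fin (n₀ + 2)) ℂ :=
    fun i => ∑ i', C (P i i') * (Γt i' - Lin i') with hB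
  have B_deg : ∀ i, (B i).totalDegree ≤ 2 := fun i =>
    totalDegree_finsetSum_le fun i' _ => (totalDegree_mul _ _).trans (by
      rw [totalDegree_C, zero_add]; exact Bt_deg i')
  have B_mem : ∀ i, ∀ d : Fin (n₀ + 2) →₀ ℕ, d.degree < 2 → coeff d (B i) = 0 := fun i =>
    degGE_sum _ fun i' _ => degGE_C_mul _ (Bt_mem i')
  have Linh_eq : ∀ i, ∑ i', C (P i i') * Lin i' = ∑ l, C ((P * J * S) i l) * X l := fun i => by
    simp_rw [Lin_eq]
    rw [sum_C_mul_linear, Matrix.mul_assoc]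
    simp only [Matrix.mul_apply]
  -- the polynomial identities `Σ_{i'} P_{i i'} Γ_{i'}(y₀ + S Y) = (P J S)_i Y + B_i(Y)`
  have sum_Γt : ∀ i, ∑ i', C (P i i') * Γt i' = ∑ l, C ((P * J * S) i l) * X l + B i := fun i => by
    rw [← Linh_eq, hB, ← Finset.sum_add_distrib]
    exact Finset.sum_congr rfl fun i' _ => by ring
  have aeval_B : ∀ i, aeval q (B i) + aeval q (∑ l, C ((P * J * S) i l) * X l) =
      ∑ i', algebraMap ℂ (LaurentSeries ℂ) (P i i') * T i' := fun i => by
    rw [← map_add, add_comm (B i), ← sum_Γt]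
    simp only [map_sum, map_mul, aeval_C, aeval_q_Γt]
  -- the special rows `0, 1, 2` have no linear part, the regular row `j' + 3` has `X_{j'+2}`
  have hsp : ∀ i : Fin (n₀ + 3), (∀ l' : Fin n₀, i ≠ l'.succ.succ.succ) →
      (∑ l, C ((P * J * S) i l) * X l : MvPolynomial (Fin (n₀ + 2)) ℂ) = 0 := fun i hi =>
    linear_E_special (P * J * S) hE0 hE1 hEs hi
  have h0 := hsp 0 fun l' => (special_ne_regular l').1
  have h1 := hsp 1 fun l' => (special_ne_regular l').2.1
  have h2 := hsp 2 fun l' => (special_ne_regular l').2.2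
  refine ⟨P, P', S, S', B, q, hPP', hP'P, hSS', hS'S, hS0, hS1, hProws, B_deg, B_mem,
    fun j g hg => q_mem j g (by exact_mod_cast hg), fun j => ?_, fun j' => ?_, ?_, ?_, ?_,
    fun j' => ?_, ?_, ?_, ?_⟩
  · exact (aeval_q_phi j).symm.trans (aeval_q_lin j)
  · have := sum_Γt j'.succ.succ.succ
    rwa [linear_E_regular (P * J * S) hE0 hE1 hEs j'] at this
  · have := sum_Γt 0
    rwa [h0, zero_add] at this
  · have := sum_Γt 1
    rwa [h1, zero_add] at this
  · have := sum_Γt 2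
    rwa [h2, zero_add] at this
  · have := aeval_B j'.succ.succ.succ
    rwa [linear_E_regular (P * J * S) hE0 hE1 hEs j', aeval_X, add_comm] at this
  · have := aeval_B 0
    rwa [h0, map_zero, add_zero] at this
  · have := aeval_B 1
    rwa [h1, map_zero, add_zero] at this
  · have := aeval_B 2
    rwa [h2, map_zero, add_zero] at this

end Summit.ValiantsHypothesis.ValiantsHypothesis.Theorems.BinomialCandidateStubs

end
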